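import Summits.AtomisticToContinuum.Crystallization.Theses.FluxTubeKepler

/-!
# Crux attack on `FluxTubeKepler.KeplerEnergyFloor` — the crux is PROVED (tree copy of the candidate proof)

Item `stmt-AtomisticToContinuum-15222`. The crux is routine bookkeeping and is PROVED here
outright (sorry-free): double counting `2E = Σ_i siteEnergy` + linearity of `siteEnergy` in the
potential give `E = Σ_i ((1/24) S₁₂,i − (1/12) S₆,i)`; DOM bounds `Σ S₆ ≤ Σ τ` (entering with the
sign `−1/12`), KEPLER at the Lennard-Jones minimal distance `δ` gives the floor and the defect
budget. A prover lands this file verbatim as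
`Summits/AtomisticToContinuum/Crystallization/Theorems/FluxTubeKeplerKeplerEnergyFloor.lean`
(evidence `Proof.lean` on the item = this file with namespace `…Theorems.FluxTubeKeplerKeplerEnergyFloor`;
this tree copy lives in a `Cruxes` namespace so the landing never collides with it).
-/

namespace Summit.AtomisticToContinuum.Crystallization.Cruxes.KeplerEnergyFloor.Attack

open scoped BigOperators
open Literature.MathematicalPhysics.StatisticalMechanics
open Summit.AtomisticToContinuum.Crystallization.Theses.FluxTubeKepler

/-- The Lennard-Jones scaling identity `E(x) = Σ_i ((1/24) S₁₂,i − (1/12) S₆,i)`. [folklore] -/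
theorem interactionEnergy_lennardJones_eq (N : ℕ) (x : Fin N → EuclideanSpace ℝ (Fin 3)) :
    interactionEnergy lennardJones x =
      ∑ i, ((1 / 24 : ℝ) * siteEnergy (fun r => (r⁻¹) ^ 12) x i -
        (1 / 12 : ℝ) * siteEnergy (fun r => (r⁻¹) ^ 6) x i) := by
  have h2 := two_mul_interactionEnergy lennardJones x
  have hsite : ∀ i, siteEnergy lennardJones x i =
      (1 / 12 : ℝ) * siteEnergy (fun r => (r⁻¹) ^ 12) x i -
        (1 / 6 : ℝ) * siteEnergy (fun r => (r⁻¹) ^ 6) x i := by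
    intro i
    simp only [siteEnergy, lennardJones, Finset.sum_sub_distrib, Finset.mul_sum]
  have hE : interactionEnergy lennardJones x = (1 / 2 : ℝ) * ∑ i, siteEnergy lennardJones x i := by
    linarith
  rw [hE, Finset.mul_sum]
  refine Finset.sum_congr rfl fun i _ => ?_
  rw [hsite i]
  ring

/-- Abstract chaining of DOM into KEPLER: a sum bound `Σ S₆ ≤ Σ T` and the cell inequality for
`(1/24) S₁₂ − (1/12) T` give the `T`-free floor. [folklore] -/
theorem floor_of_dom_kepler {ι : Type*} [Fintype ι] (S₁₂ S₆ T : ι → ℝ) (K E c : ℝ)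
    (hDOM : ∑ i, S₆ i ≤ ∑ i, T i)
    (hKEP : c * K ≤ ∑ i, ((1 / 24 : ℝ) * S₁₂ i - (1 / 12 : ℝ) * T i) - E) :
    E + c * K ≤ ∑ i, ((1 / 24 : ℝ) * S₁₂ i - (1 / 12 : ℝ) * S₆ i) := by
  have h3 : ∑ i, ((1 / 24 : ℝ) * S₁₂ i - (1 / 12 : ℝ) * T i) ≤
      ∑ i, ((1 / 24 : ℝ) * S₁₂ i - (1 / 12 : ℝ) * S₆ i) := by
    simp only [Finset.sum_sub_distrib, ← Finset.mul_sum]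
    linarith
  linarith

/-- `KeplerEnergyFloor` holds (unconditionally, as an implication from `FluxCellKepler` and
`LennardJonesMinimalDistance`). [folklore] -/
theorem keplerEnergyFloor : KeplerEnergyFloor := by
  intro hK hmd
  obtain ⟨P₀, R₁, τ, hDOM, hKEP⟩ := hK
  obtain ⟨δ, hδ, hsep⟩ := hmd
  refine ⟨P₀, ?_, ?_⟩
  · intro N x hx
    obtain ⟨c, hc, h⟩ := hKEP δ hδ 1 1 one_pos one_pos
    have h1 := floor_of_dom_kepler _ _ _ _ _ _ (hDOM N x hx.1) (h N x hx.1 (hsep N x hx))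
    rw [← interactionEnergy_lennardJones_eq] at h1
    have hcK : 0 ≤ c * (Nat.card {i : Fin N // ¬ ∃ a : ℝ, 47 / 50 ≤ a ∧ a ≤ 1 ∧ ∃ (A : EuclideanSpace ℝ (Fin 3) →ₗᵢ[ℝ] EuclideanSpace ℝ (Fin 3)) (s : ℤ → ℤ) (z : ℤ → ℝ), IsHaggSeq s ∧ (∀ m : ℤ, 39 / 50 * a ≤ z (m + 1) - z m ∧ z (m + 1) - z m ≤ 17 / 20 * a) ∧ let S : Set (EuclideanSpace ℝ (Fin 3)) := {p | ∃ m k l : ℤ, p = A (((k : ℝ) • triangularVec₁ a) + ((l : ℝ) • triangularVec₂ a) + ((haggLabel s m : ℝ) • barlowOffset a) + (z m • layerNormal 1))}; (∀ p ∈ S, ‖p‖ ≤ (1 : ℝ) → ∃ j : Fin N, dist (x j - x i) p ≤ (1 : ℝ)) ∧ (∀ j : Fin N, ‖x j - x i‖ ≤ (1 : ℝ) → ∃ p ∈ S, dist (x j - x i) p ≤ (1 : ℝ))} : ℝ) :=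
      mul_nonneg hc.le (Nat.cast_nonneg _)
    linarith
  · intro R η hR hη
    obtain ⟨c, hc, h⟩ := hKEP δ hδ R η hR hη
    refine ⟨c, hc, fun N x hx => ?_⟩
    have h1 := floor_of_dom_kepler _ _ _ _ _ _ (hDOM N x hx.1) (h N x hx.1 (hsep N x hx))
    rw [← interactionEnergy_lennardJones_eq] at h1
    linarith

end Summit.AtomisticToContinuum.Crystallization.Cruxes.KeplerEnergyFloor.Attack
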